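import Mathlib.Analysis.SpecialFunctions.Log.Deriv
import Mathlib.Analysis.SpecialFunctions.ExpDeriv
import Mathlib.Analysis.Calculus.Deriv.MeanValue
import Mathlib.Algebra.Order.Chebyshev
import HarnessLib

/-!
# The first three cumulants of a finite weighted family: derivatives of `t ↦ log Σ w_i e^{t x_i}` and the bound `|κ₃| ≤ R·κ₂`

For a finite nonempty family of positive weights `w_i` and real values `x_i` (a finite Gibbs measure / partition function), the
log-Laplace transform `Λ(t) = log Z(t)`, `Z(t) = Σ_i w_i e^{t x_i}`, has
* §1 `Λ' = m(t)` (the tilted mean `Σ w_i x_i e^{t x_i}/Z`), `Λ'' = v(t)` (the tilted variance `Σ w_i (x_i − m)² e^{t x_i}/Z ≥ 0`), and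
  `v' = κ₃(t)` (the tilted third central moment `Σ w_i (x_i − m)³ e^{t x_i}/Z`);
* §2 ★★ if all values lie in an interval of length `R` then `|κ₃| ≤ R·v` — the third cumulant is at most the range times the variance —
  so the variance, as a function of the tilt, does not oscillate on scales `≪ 1/R`: `v(t) ≤ e^{R t} v(0)` and `v(0) ≤ e^{R t} v(t)` (`t ≥ 0`).
This is the model-free input of the lane's variance programme (`Literature/Analysis/Calculus/QuasiLinearSecondDerivative.lean` takes exactly
these two facts as hypotheses): for the contact number of an `N`-step strip walk, `R = N + 1`.  (The same partition function `Z(t)` is the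
tree's `tiltedSum` of `MathematicalPhysics/QuantumFieldTheory/Balaban1983to89/B14Interpolation.lean`, which has `Z > 0` and `(log Z)' = ⟨Y⟩_t`;
the statements here are def-free on the explicit sums and add the second and third cumulants.)

## Sources
DemboZeitouni2010 §2.2 (the logarithmic moment generating function, its derivatives as tilted mean and variance; lane statement of the third-cumulant
bound).  Nothing quoted AS PRINTED; elementary calculus.
-/

noncomputable section

open Finset Set

namespace Literature.Probability.Moments

variable {ι : Type*} (s : Finset ι) (w x : ι → ℝ)

/-! ## §1 Derivatives of the finite log-Laplace transform -/

/-- The tilted partition function `Z(t) = Σ_{i∈s} w_i e^{t x_i}` has derivative `Σ w_i x_i e^{t x_i}`.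
[cite: DemboZeitouni2010, §2.2 (lane plumbing)] -/
theorem hasDerivAt_finLaplace_sum (t : ℝ) :
    HasDerivAt (fun t => ∑ i ∈ s, w i * Real.exp (t * x i)) (∑ i ∈ s, w i * x i * Real.exp (t * x i)) t := by
  have h : ∀ i ∈ s, HasDerivAt (fun t => w i * Real.exp (t * x i)) (w i * x i * Real.exp (t * x i)) t := by
    intro i _
    have h1 : HasDerivAt (fun t => t * x i) (x i) t := by simpa using (hasDerivAt_id t).mul_const (x i)
    have h2 := h1.exp.const_mul (w i)
    simpa [mul_comm, mul_assoc, mul_left_comm] using h2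
  simpa only [Finset.sum_fn] using HasDerivAt.sum h

/-- The `k`-th tilted moment sum `Σ w_i x_i^k e^{t x_i}` has derivative `Σ w_i x_i^{k+1} e^{t x_i}`.
[cite: DemboZeitouni2010, §2.2 (lane plumbing)] -/
theorem hasDerivAt_finLaplace_momentSum (k : ℕ) (t : ℝ) :
    HasDerivAt (fun t => ∑ i ∈ s, w i * x i ^ k * Real.exp (t * x i)) (∑ i ∈ s, w i * x i ^ (k + 1) * Real.exp (t * x i)) t := by
  have h : ∀ i ∈ s, HasDerivAt (fun t => w i * x i ^ k * Real.exp (t * x i)) (w i * x i ^ (k + 1) * Real.exp (t * x i)) t := by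
    intro i _
    have h1 : HasDerivAt (fun t => t * x i) (x i) t := by simpa using (hasDerivAt_id t).mul_const (x i)
    have h2 := h1.exp.const_mul (w i * x i ^ k)
    simpa [mul_comm, mul_assoc, mul_left_comm, pow_succ] using h2
  simpa only [Finset.sum_fn] using HasDerivAt.sum h

variable {s w x}

/-- `Z(t) > 0` for positive weights on a nonempty index set. [cite: DemboZeitouni2010, §2.2 (lane plumbing)] -/
theorem finLaplace_sum_pos (hs : s.Nonempty) (hw : ∀ i ∈ s, 0 < w i) (t : ℝ) : 0 < ∑ i ∈ s, w i * Real.exp (t * x i) :=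
  Finset.sum_pos (fun i hi => mul_pos (hw i hi) (Real.exp_pos _)) hs

/-- ★ **`Λ'(t) = m(t)`**: the log-Laplace transform `Λ(t) = log Σ w_i e^{t x_i}` has derivative the tilted mean `(Σ w_i x_i e^{t x_i})/Z(t)`.
[cite: DemboZeitouni2010, §2.2 (lane statement)] -/
theorem hasDerivAt_log_finLaplace (hs : s.Nonempty) (hw : ∀ i ∈ s, 0 < w i) (t : ℝ) :
    HasDerivAt (fun t => Real.log (∑ i ∈ s, w i * Real.exp (t * x i)))
      ((∑ i ∈ s, w i * x i * Real.exp (t * x i)) / ∑ i ∈ s, w i * Real.exp (t * x i)) t := by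
  have hZ := finLaplace_sum_pos (x := x) hs hw t
  exact (hasDerivAt_finLaplace_sum s w x t).log hZ.ne'

/-- ★ **`m'(t) = v(t)`**: the tilted mean has derivative `M₂/Z − (M₁/Z)²` (`M_k = Σ w_i x_i^k e^{t x_i}`), the tilted variance.
[cite: DemboZeitouni2010, §2.2 (lane statement)] -/
theorem hasDerivAt_finLaplace_mean (hs : s.Nonempty) (hw : ∀ i ∈ s, 0 < w i) (t : ℝ) :
    HasDerivAt (fun t => (∑ i ∈ s, w i * x i * Real.exp (t * x i)) / ∑ i ∈ s, w i * Real.exp (t * x i))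
      ((∑ i ∈ s, w i * x i ^ 2 * Real.exp (t * x i)) / (∑ i ∈ s, w i * Real.exp (t * x i)) -
        ((∑ i ∈ s, w i * x i * Real.exp (t * x i)) / ∑ i ∈ s, w i * Real.exp (t * x i)) ^ 2) t := by
  have hZ := finLaplace_sum_pos (x := x) hs hw t
  have h1 := hasDerivAt_finLaplace_momentSum s w x 1 t
  simp only [pow_one, Nat.reduceAdd] at h1
  have h0 := hasDerivAt_finLaplace_sum s w x t
  have h := h1.div h0 hZ.ne'
  refine h.congr_deriv ?_
  have hZ0 : (∑ i ∈ s, w i * Real.exp (t * x i)) ≠ 0 := hZ.ne'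
  generalize (∑ i ∈ s, w i * x i ^ 2 * Real.exp (t * x i)) = A
  generalize (∑ i ∈ s, w i * x i * Real.exp (t * x i)) = M
  generalize hZ' : (∑ i ∈ s, w i * Real.exp (t * x i)) = Z at hZ0 ⊢
  field_simp

/-- ★ **`v'(t) = κ₃(t)`**: the tilted variance `M₂/Z − (M₁/Z)²` has derivative `M₃/Z − 3(M₂/Z)(M₁/Z) + 2(M₁/Z)³`, the tilted third
central moment. [cite: DemboZeitouni2010, §2.2 (lane statement)] -/
theorem hasDerivAt_finLaplace_var (hs : s.Nonempty) (hw : ∀ i ∈ s, 0 < w i) (t : ℝ) :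
    HasDerivAt (fun t => (∑ i ∈ s, w i * x i ^ 2 * Real.exp (t * x i)) / (∑ i ∈ s, w i * Real.exp (t * x i)) -
        ((∑ i ∈ s, w i * x i * Real.exp (t * x i)) / ∑ i ∈ s, w i * Real.exp (t * x i)) ^ 2)
      ((∑ i ∈ s, w i * x i ^ 3 * Real.exp (t * x i)) / (∑ i ∈ s, w i * Real.exp (t * x i)) -
        3 * ((∑ i ∈ s, w i * x i ^ 2 * Real.exp (t * x i)) / ∑ i ∈ s, w i * Real.exp (t * x i)) *
          ((∑ i ∈ s, w i * x i * Real.exp (t * x i)) / ∑ i ∈ s, w i * Real.exp (t * x i)) +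
        2 * ((∑ i ∈ s, w i * x i * Real.exp (t * x i)) / ∑ i ∈ s, w i * Real.exp (t * x i)) ^ 3) t := by
  have hZ := finLaplace_sum_pos (x := x) hs hw t
  have hZ0 : (∑ i ∈ s, w i * Real.exp (t * x i)) ≠ 0 := hZ.ne'
  have h2 := hasDerivAt_finLaplace_momentSum s w x 2 t
  simp only [Nat.reduceAdd] at h2
  have h0 := hasDerivAt_finLaplace_sum s w x t
  have hA := h2.div h0 hZ0
  have hm := hasDerivAt_finLaplace_mean (x := x) hs hw t
  have hB := hm.mul hm
  have e : (fun t => (∑ i ∈ s, w i * x i ^ 2 * Real.exp (t * x i)) / (∑ i ∈ s, w i * Real.exp (t * x i)) -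
        ((∑ i ∈ s, w i * x i * Real.exp (t * x i)) / ∑ i ∈ s, w i * Real.exp (t * x i)) ^ 2) =
      (fun t => (∑ i ∈ s, w i * x i ^ 2 * Real.exp (t * x i)) / (∑ i ∈ s, w i * Real.exp (t * x i)) -
        ((∑ i ∈ s, w i * x i * Real.exp (t * x i)) / ∑ i ∈ s, w i * Real.exp (t * x i)) *
        ((∑ i ∈ s, w i * x i * Real.exp (t * x i)) / ∑ i ∈ s, w i * Real.exp (t * x i))) := by
    funext u; ring
  rw [e]
  refine (hA.sub hB).congr_deriv ?_
  generalize (∑ i ∈ s, w i * x i ^ 3 * Real.exp (t * x i)) = A₃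
  generalize (∑ i ∈ s, w i * x i ^ 2 * Real.exp (t * x i)) = A₂
  generalize (∑ i ∈ s, w i * x i * Real.exp (t * x i)) = M
  generalize hZ' : (∑ i ∈ s, w i * Real.exp (t * x i)) = Z at hZ0 ⊢
  field_simp
  ring

/-! ## §2 Central forms and the third-cumulant bound -/

/-- **The variance in central form**: `M₂/Z − (M₁/Z)² = (Σ w_i (x_i − m)² e^{t x_i})/Z` with `m = M₁/Z`; in particular it is `≥ 0`.
[cite: DemboZeitouni2010, §2.2 (lane statement)] -/
theorem finLaplace_var_eq_central (hs : s.Nonempty) (hw : ∀ i ∈ s, 0 < w i) (t : ℝ) :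
    (∑ i ∈ s, w i * x i ^ 2 * Real.exp (t * x i)) / (∑ i ∈ s, w i * Real.exp (t * x i)) -
        ((∑ i ∈ s, w i * x i * Real.exp (t * x i)) / ∑ i ∈ s, w i * Real.exp (t * x i)) ^ 2 =
      (∑ i ∈ s, w i * (x i - (∑ j ∈ s, w j * x j * Real.exp (t * x j)) / ∑ j ∈ s, w j * Real.exp (t * x j)) ^ 2 *
        Real.exp (t * x i)) / ∑ i ∈ s, w i * Real.exp (t * x i) := by
  have hZ := finLaplace_sum_pos (x := x) hs hw t
  set Z := ∑ i ∈ s, w i * Real.exp (t * x i) with hZdef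
  set M₁ := ∑ i ∈ s, w i * x i * Real.exp (t * x i) with hM₁
  set M₂ := ∑ i ∈ s, w i * x i ^ 2 * Real.exp (t * x i) with hM₂
  have hexp : ∑ i ∈ s, w i * (x i - M₁ / Z) ^ 2 * Real.exp (t * x i) = M₂ - 2 * (M₁ / Z) * M₁ + (M₁ / Z) ^ 2 * Z := by
    have e : ∀ i ∈ s, w i * (x i - M₁ / Z) ^ 2 * Real.exp (t * x i) =
        w i * x i ^ 2 * Real.exp (t * x i) - 2 * (M₁ / Z) * (w i * x i * Real.exp (t * x i)) + (M₁ / Z) ^ 2 * (w i * Real.exp (t * x i)) := by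
      intro i _; ring
    rw [Finset.sum_congr rfl e, Finset.sum_add_distrib, Finset.sum_sub_distrib, ← Finset.mul_sum, ← Finset.mul_sum]
  rw [hexp]
  field_simp
  ring

/-- The tilted variance is nonnegative. [cite: DemboZeitouni2010, §2.2 (lane statement)] -/
theorem finLaplace_var_nonneg (hs : s.Nonempty) (hw : ∀ i ∈ s, 0 < w i) (t : ℝ) :
    0 ≤ (∑ i ∈ s, w i * x i ^ 2 * Real.exp (t * x i)) / (∑ i ∈ s, w i * Real.exp (t * x i)) -
        ((∑ i ∈ s, w i * x i * Real.exp (t * x i)) / ∑ i ∈ s, w i * Real.exp (t * x i)) ^ 2 := by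
  rw [finLaplace_var_eq_central hs hw t]
  refine div_nonneg (Finset.sum_nonneg fun i hi => ?_) (finLaplace_sum_pos (x := x) hs hw t).le
  exact mul_nonneg (mul_nonneg (hw i hi).le (sq_nonneg _)) (Real.exp_pos _).le

/-- **The third cumulant in central form**: `M₃/Z − 3(M₂/Z)(M₁/Z) + 2(M₁/Z)³ = (Σ w_i (x_i − m)³ e^{t x_i})/Z`.
[cite: DemboZeitouni2010, §2.2 (lane statement)] -/
theorem finLaplace_third_eq_central (hs : s.Nonempty) (hw : ∀ i ∈ s, 0 < w i) (t : ℝ) :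
    (∑ i ∈ s, w i * x i ^ 3 * Real.exp (t * x i)) / (∑ i ∈ s, w i * Real.exp (t * x i)) -
        3 * ((∑ i ∈ s, w i * x i ^ 2 * Real.exp (t * x i)) / ∑ i ∈ s, w i * Real.exp (t * x i)) *
          ((∑ i ∈ s, w i * x i * Real.exp (t * x i)) / ∑ i ∈ s, w i * Real.exp (t * x i)) +
        2 * ((∑ i ∈ s, w i * x i * Real.exp (t * x i)) / ∑ i ∈ s, w i * Real.exp (t * x i)) ^ 3 =
      (∑ i ∈ s, w i * (x i - (∑ j ∈ s, w j * x j * Real.exp (t * x j)) / ∑ j ∈ s, w j * Real.exp (t * x j)) ^ 3 *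
        Real.exp (t * x i)) / ∑ i ∈ s, w i * Real.exp (t * x i) := by
  have hZ := finLaplace_sum_pos (x := x) hs hw t
  set Z := ∑ i ∈ s, w i * Real.exp (t * x i) with hZdef
  set M₁ := ∑ i ∈ s, w i * x i * Real.exp (t * x i) with hM₁
  set M₂ := ∑ i ∈ s, w i * x i ^ 2 * Real.exp (t * x i) with hM₂
  set M₃ := ∑ i ∈ s, w i * x i ^ 3 * Real.exp (t * x i) with hM₃
  have hexp : ∑ i ∈ s, w i * (x i - M₁ / Z) ^ 3 * Real.exp (t * x i) =
      M₃ - 3 * (M₁ / Z) * M₂ + 3 * (M₁ / Z) ^ 2 * M₁ - (M₁ / Z) ^ 3 * Z := by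
    have e : ∀ i ∈ s, w i * (x i - M₁ / Z) ^ 3 * Real.exp (t * x i) =
        w i * x i ^ 3 * Real.exp (t * x i) - 3 * (M₁ / Z) * (w i * x i ^ 2 * Real.exp (t * x i))
          + 3 * (M₁ / Z) ^ 2 * (w i * x i * Real.exp (t * x i)) - (M₁ / Z) ^ 3 * (w i * Real.exp (t * x i)) := by
      intro i _; ring
    rw [Finset.sum_congr rfl e, Finset.sum_sub_distrib, Finset.sum_add_distrib, Finset.sum_sub_distrib, ← Finset.mul_sum,
      ← Finset.mul_sum, ← Finset.mul_sum]
  rw [hexp]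
  field_simp
  ring

/-- ★★ **THE THIRD CUMULANT IS AT MOST THE RANGE TIMES THE VARIANCE**: if every value satisfies `a ≤ x_i ≤ a + R` then
`|κ₃(t)| ≤ R · v(t)` for every tilt `t` (`|x_i − m| ≤ R` since the mean `m` lies in `[a, a+R]`).
[cite: DemboZeitouni2010, §2.2 (lane statement)] -/
theorem abs_finLaplace_third_le (hs : s.Nonempty) (hw : ∀ i ∈ s, 0 < w i) {a R : ℝ} (hx : ∀ i ∈ s, a ≤ x i ∧ x i ≤ a + R) (t : ℝ) :
    |(∑ i ∈ s, w i * x i ^ 3 * Real.exp (t * x i)) / (∑ i ∈ s, w i * Real.exp (t * x i)) -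
        3 * ((∑ i ∈ s, w i * x i ^ 2 * Real.exp (t * x i)) / ∑ i ∈ s, w i * Real.exp (t * x i)) *
          ((∑ i ∈ s, w i * x i * Real.exp (t * x i)) / ∑ i ∈ s, w i * Real.exp (t * x i)) +
        2 * ((∑ i ∈ s, w i * x i * Real.exp (t * x i)) / ∑ i ∈ s, w i * Real.exp (t * x i)) ^ 3| ≤
      R * ((∑ i ∈ s, w i * x i ^ 2 * Real.exp (t * x i)) / (∑ i ∈ s, w i * Real.exp (t * x i)) -
        ((∑ i ∈ s, w i * x i * Real.exp (t * x i)) / ∑ i ∈ s, w i * Real.exp (t * x i)) ^ 2) := by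
  rw [finLaplace_third_eq_central hs hw t, finLaplace_var_eq_central hs hw t]
  have hZ := finLaplace_sum_pos (x := x) hs hw t
  set Z := ∑ i ∈ s, w i * Real.exp (t * x i) with hZdef
  set m := (∑ j ∈ s, w j * x j * Real.exp (t * x j)) / Z with hm
  -- the mean lies in `[a, a + R]`
  have hm1 : a ≤ m := by
    rw [hm, le_div_iff₀ hZ, hZdef, Finset.mul_sum]
    exact Finset.sum_le_sum fun i hi => by
      have := (hx i hi).1
      have hwe : 0 ≤ w i * Real.exp (t * x i) := (mul_pos (hw i hi) (Real.exp_pos _)).le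
      nlinarith
  have hm2 : m ≤ a + R := by
    rw [hm, div_le_iff₀ hZ, hZdef, Finset.mul_sum]
    exact Finset.sum_le_sum fun i hi => by
      have := (hx i hi).2
      have hwe : 0 ≤ w i * Real.exp (t * x i) := (mul_pos (hw i hi) (Real.exp_pos _)).le
      nlinarith
  -- termwise: `|w (x−m)³ e| ≤ R · w (x−m)² e`
  rw [abs_div, abs_of_pos hZ, ← mul_div_assoc, div_le_div_iff_of_pos_right hZ, Finset.mul_sum]
  refine (Finset.abs_sum_le_sum_abs _ _).trans (Finset.sum_le_sum fun i hi => ?_)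
  have hwe : 0 ≤ w i * Real.exp (t * x i) := (mul_pos (hw i hi) (Real.exp_pos _)).le
  have hd : |x i - m| ≤ R := by
    rw [abs_le]; constructor <;> linarith [(hx i hi).1, (hx i hi).2]
  rw [show w i * (x i - m) ^ 3 * Real.exp (t * x i) = (x i - m) * ((x i - m) ^ 2 * (w i * Real.exp (t * x i))) by ring,
    abs_mul, show R * (w i * (x i - m) ^ 2 * Real.exp (t * x i)) = R * ((x i - m) ^ 2 * (w i * Real.exp (t * x i))) by ring]
  have hnn : 0 ≤ (x i - m) ^ 2 * (w i * Real.exp (t * x i)) := mul_nonneg (sq_nonneg _) hwe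
  rw [abs_of_nonneg hnn]
  exact mul_le_mul_of_nonneg_right hd hnn

/-- ★★ **The tilted variance does not oscillate on scales `≪ 1/R`**: with values in `[a, a+R]`, for `0 ≤ t`:
`v(t) ≤ e^{Rt} v(0)` and `v(0) ≤ e^{Rt} v(t)` (Grönwall on `|v'| ≤ R v`).  With `R = N` this is the oscillation hypothesis of
`Literature.Analysis.tendsto_deriv2_div_of_quasiLinear`. [cite: DemboZeitouni2010, §2.2 (lane statement)] -/
theorem finLaplace_var_le_exp_mul (hs : s.Nonempty) (hw : ∀ i ∈ s, 0 < w i) {a R : ℝ} (hx : ∀ i ∈ s, a ≤ x i ∧ x i ≤ a + R)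
    {t : ℝ} (ht : 0 ≤ t) :
    let v : ℝ → ℝ := fun t => (∑ i ∈ s, w i * x i ^ 2 * Real.exp (t * x i)) / (∑ i ∈ s, w i * Real.exp (t * x i)) -
        ((∑ i ∈ s, w i * x i * Real.exp (t * x i)) / ∑ i ∈ s, w i * Real.exp (t * x i)) ^ 2
    v t ≤ Real.exp (R * t) * v 0 ∧ v 0 ≤ Real.exp (R * t) * v t := by
  intro v
  set κ : ℝ → ℝ := fun t => (∑ i ∈ s, w i * x i ^ 3 * Real.exp (t * x i)) / (∑ i ∈ s, w i * Real.exp (t * x i)) -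
        3 * ((∑ i ∈ s, w i * x i ^ 2 * Real.exp (t * x i)) / ∑ i ∈ s, w i * Real.exp (t * x i)) *
          ((∑ i ∈ s, w i * x i * Real.exp (t * x i)) / ∑ i ∈ s, w i * Real.exp (t * x i)) +
        2 * ((∑ i ∈ s, w i * x i * Real.exp (t * x i)) / ∑ i ∈ s, w i * Real.exp (t * x i)) ^ 3 with hκ
  have hderiv : ∀ u : ℝ, HasDerivAt v (κ u) u := fun u => hasDerivAt_finLaplace_var (x := x) hs hw u
  have hbound : ∀ u : ℝ, |κ u| ≤ R * v u := fun u => abs_finLaplace_third_le hs hw hx u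
  -- `v e^{−Ru}` antitone and `v e^{Ru}` monotone on `[0, t]`
  have hcont : Continuous v := by
    have : ∀ u, ContinuousAt v u := fun u => (hderiv u).continuousAt
    exact continuous_iff_continuousAt.2 this
  have hanti : AntitoneOn (fun u => v u * Real.exp (-(R * u))) (Icc 0 t) := by
    refine antitoneOn_of_deriv_nonpos (convex_Icc 0 t) ?_ ?_ ?_
    · exact (hcont.mul (by fun_prop)).continuousOn
    · intro u _
      exact ((hderiv u).mul (((hasDerivAt_id u).const_mul R).neg.exp)).differentiableAt.differentiableWithinAt
    · intro u _
      have hd : HasDerivAt (fun u => v u * Real.exp (-(R * u))) (κ u * Real.exp (-(R * u)) + v u * (Real.exp (-(R * u)) * (-R))) u := by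
        have h2 : HasDerivAt (fun u => Real.exp (-(R * u))) (Real.exp (-(R * u)) * (-R)) u := by
          have := ((hasDerivAt_id u).const_mul R).neg.exp; simpa using this
        exact (hderiv u).mul h2
      rw [hd.deriv]
      have := (abs_le.1 (hbound u)).2
      nlinarith [Real.exp_pos (-(R * u))]
  have hmono : MonotoneOn (fun u => v u * Real.exp (R * u)) (Icc 0 t) := by
    refine monotoneOn_of_deriv_nonneg (convex_Icc 0 t) ?_ ?_ ?_
    · exact (hcont.mul (by fun_prop)).continuousOn
    · intro u _
      exact ((hderiv u).mul (((hasDerivAt_id u).const_mul R).exp)).differentiableAt.differentiableWithinAt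
    · intro u _
      have hd : HasDerivAt (fun u => v u * Real.exp (R * u)) (κ u * Real.exp (R * u) + v u * (Real.exp (R * u) * R)) u := by
        have h2 : HasDerivAt (fun u => Real.exp (R * u)) (Real.exp (R * u) * R) u := by
          have := ((hasDerivAt_id u).const_mul R).exp; simpa using this
        exact (hderiv u).mul h2
      rw [hd.deriv]
      have := (abs_le.1 (hbound u)).1
      nlinarith [Real.exp_pos (R * u)]
  have h0 : (0 : ℝ) ∈ Icc 0 t := ⟨le_rfl, ht⟩
  have h1 : t ∈ Icc 0 t := ⟨ht, le_rfl⟩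
  have ha := hanti h0 h1 ht
  have hb := hmono h0 h1 ht
  simp only [mul_zero, neg_zero, Real.exp_zero, mul_one] at ha hb
  have hE := Real.exp_pos (R * t)
  have hEE : Real.exp (R * t) * Real.exp (-(R * t)) = 1 := by rw [← Real.exp_add]; simp
  constructor
  · calc v t = Real.exp (R * t) * (v t * Real.exp (-(R * t))) := by rw [mul_comm (v t), ← mul_assoc, hEE, one_mul]
      _ ≤ Real.exp (R * t) * v 0 := mul_le_mul_of_nonneg_left ha hE.le
  · calc v 0 ≤ v t * Real.exp (R * t) := hb
      _ = Real.exp (R * t) * v t := mul_comm _ _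

end Literature.Probability.Moments
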